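import Literature.Algebra.Polynomial.DescartesSignVariations
import Literature.Algebra.Polynomial.LacunaryBivariateOnLine
import Summits.ValiantsHypothesis.ValiantsHypothesis.Theorems.KPlusLogSqLawTridiagonalRealStaticPotentialSteps
import Summits.ValiantsHypothesis.ValiantsHypothesis.Theorems.KPlusLogSqLawTridiagonalRealStaticPotentialGame

/-!
# Route «KPlusLogSqLaw», crux `WeakLifting` (stmt-ValiantsHypothesis-19561) — REAL side of the tridiagonal sector:
# `(P)_2` («(P) at `m = 4`») REDUCES TO «`B 4 ≤ 3` WITH MULTIPLICITY» by counting

HONEST FRAMING.  Helper (`--supports stmt-ValiantsHypothesis-19561 --as helper`), seat val-sym-lift-p3 (g10), cell `pub-symmetroid`,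
2026-08-27.  Desk R2278: «a first kernel instance «(P) at `m = 4`» would be a fine rung».  This file proves the IMPLICATION
`potentialStep_two_of_fourMult`: IF every static definite symmetric tridiagonal `4 × 4` monomial design with nonzero links has at most THREE
positive determinant zeros COUNTED WITH MULTIPLICITY (hypothesis stated inline; the cell's kernel row `B 4 ≤ 3`, lift-p2 g9
`card_posRoots_four_le_three_all`, counts DISTINCT zeros — the multiplicity form is proved in the companion file from it), THEN the step
`(P)_2` of conjecture (P) holds: `Θ(rootWord D₃ D₄) ≤ Θ(rootWord D₂ D₃) + 2`.  Pure counting: with `n₂ ≤ 1`, `n₃ ≤ 2` (Descartes, `…PotentialSteps`),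
`n₄ ≤ 3` (the hypothesis) and `n₂ = 0 ⇒ n₄ ≤ 2` (`countP_roots_pos_pathDet_four_le_two_of_two`: a zero-free `D₂ ≠ 0` is a monomial — otherwise
Descartes' exact count `Var = 1 ⇒ one positive root` — and then `D₄` is a trinomial), the bounds `Θ(w) ≤ |w|`, `Θ(w) ≤ |w| − 1` when both letters
occur (`theta_le_length_sub_one`) and `Θ(u) ≥ #p(u), #q(u)` close every case.  Nothing is proved about (P) beyond `k = 2`; α does not move.
Nothing here bears on `WeakLifting` / `TropicalB` (stmt-19771) in their windows, on Conjecture B, on the Door-A registers, on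
`MatrixDescartes` (stmt-ValiantsHypothesis-18050) or on VP ≠ VNP.
[folklore: Descartes' rule of signs; this cell's memo CONDITIONAL-UPPER-ROW-liftp3g10.md §6]
-/

-- `Summit.ValiantsHypothesis.ValiantsHypothesis.…` repeats a component by the D-0017 layout (single-conjunct summit); the name is mandated.
set_option linter.dupNamespace false
set_option autoImplicit false

namespace Summit.ValiantsHypothesis.ValiantsHypothesis.Theorems.KPlusLogSqLaw

namespace StaticTridiagonalRealPotential

open Polynomial Finset
open Literature.Algebra.Polynomial.Descartes (countP_roots_pos_eq_one_of_signVariations_eq_one)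
open Literature.Algebra.Polynomial (signVariations_C_mul_X_pow_add)

/-! ### A word containing both letters has potential at most its length minus one -/

/-- A label list without changes is constant. [bookkeeping] -/
theorem eq_replicate_of_changes_eq_zero : ∀ (l : List Bool) (c : Bool), changes (c :: l) = 0 → c :: l = List.replicate (l.length + 1) c
  | [], c, _ => rfl
  | b :: l, c, h => by
    rw [changes_cons_cons] at h
    have hcb : c = b := by
      by_contra hne
      rw [if_neg hne] at h
      omega
    subst hcb
    rw [if_pos rfl, Nat.zero_add] at h
    rw [List.length_cons, List.replicate_succ, eq_replicate_of_changes_eq_zero l c h]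

/-- Against a constant label list the agreements are the letter count. [bookkeeping] -/
theorem agreements_replicate : ∀ (w : List Bool) (c : Bool), agreements w (List.replicate w.length c) = w.count c
  | [], c => by simp
  | a :: w, c => by
    rw [List.length_cons, List.replicate_succ, agreements_cons, agreements_replicate w c, List.count_cons]
    by_cases h : a = c <;> simp [h, Nat.add_comm]

/-- **`Θ(w) ≤ |w| − 1` as soon as `w` contains both letters**: a constant labeling misses the other letter, a non-constant one pays a change. -/
theorem theta_le_length_sub_one (w : List Bool) (ht : 1 ≤ w.count true) (hf : 1 ≤ w.count false) :
    theta w ≤ w.length - 1 := by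
  refine theta_le_of_forall _ _ fun l hl => ?_
  have hlen := agreements_le_length_right w l
  rcases l with _ | ⟨c, l⟩
  · -- `l = []` forces `w = []`, contradicting `ht`
    have h0 : w.length = 0 := by simpa using hl.symm
    have h1 : w.count true ≤ w.length := List.count_le_length
    omega
  · by_cases hch : changes (c :: l) = 0
    · rw [eq_replicate_of_changes_eq_zero l c hch, changes_replicate]
      have hl' : l.length + 1 = w.length := by simpa using hl
      rw [hl', agreements_replicate]
      have h1 := List.count_not_add_count w c
      cases c
      · simp only [Bool.not_false] at h1; omega
      · simp only [Bool.not_true] at h1; omega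
    · rw [hl] at hlen
      omega

/-! ### `n₂ = 0 ⇒ n₄ ≤ 2`: a zero-free `D₂` is a monomial, and then `D₄` is a trinomial -/

variable (a : ℕ → ℝ) (d : ℕ → ℕ) (b : ℕ → ℝ) (f : ℕ → ℕ)

/-- If the two exponents of the binomial `D₂` differ, `D₂` has EXACTLY ONE positive zero (Descartes: one sign variation). [folklore] -/
theorem countP_roots_pos_pathDet_two_eq_one (ha : ∀ t, 0 < a t) (hb : ∀ t, b t ≠ 0) (hne : d 1 + d 0 ≠ 2 * f 0) :
    (pathDet a d b f 2).roots.countP (fun x => 0 < x) = 1 := by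
  refine countP_roots_pos_eq_one_of_signVariations_eq_one ?_
  rw [pathDet_two]
  have hpos : 0 < a 1 * a 0 := mul_pos (ha 1) (ha 0)
  have hb0 : 0 < b 0 ^ 2 := lt_of_le_of_ne (sq_nonneg _) (Ne.symm (pow_ne_zero 2 (hb 0)))
  have hneg : -(b 0 ^ 2) < 0 := neg_neg_of_pos hb0
  rcases lt_or_gt_of_ne hne with hlt | hgt
  · -- leading term `−b₀² X^{2f₀}`
    rw [add_comm, signVariations_C_mul_X_pow_add hneg.ne (lt_of_le_of_lt (degree_C_mul_X_pow_le _ _) (by exact_mod_cast hlt)),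
      C_mul_X_pow_eq_monomial, signVariations_monomial, leadingCoeff_monomial, if_pos]
    rw [sign_neg hneg, sign_pos hpos]
  · rw [signVariations_C_mul_X_pow_add hpos.ne' (lt_of_le_of_lt (degree_C_mul_X_pow_le _ _) (by exact_mod_cast hgt)),
      C_mul_X_pow_eq_monomial, signVariations_monomial, leadingCoeff_monomial, if_pos]
    rw [sign_pos hpos, sign_neg hneg, neg_neg]

/-- **`n₂ = 0 ⇒ n₄ ≤ 2`**: if `D₂` has no positive zero then `D₄` has at most two, counted with multiplicity.  (`D₂ = 0`: `D₄ = −L₃w₁L₀` is a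
monomial; `D₂ ≠ 0` zero-free forces equal exponents, `D₂ = γX^E`, and `D₄ = a₃X^{d₃}D₃ − b₂²X^{2f₂}·γX^E` has three terms.) [folklore: Descartes] -/
theorem countP_roots_pos_pathDet_four_le_two_of_two (ha : ∀ t, 0 < a t) (hb : ∀ t, b t ≠ 0)
    (h2 : (pathDet a d b f 2).roots.countP (fun x => 0 < x) = 0) :
    (pathDet a d b f 4).roots.countP (fun x => 0 < x) ≤ 2 := by
  -- the exponents of `D₂` coincide (otherwise exactly one positive zero)
  have heq : d 1 + d 0 = 2 * f 0 := by
    by_contra hne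
    have := countP_roots_pos_pathDet_two_eq_one a d b f ha hb hne
    omega
  have hD2 : pathDet a d b f 2 = C (a 1 * a 0 - b 0 ^ 2) * X ^ (2 * f 0) := by
    rw [pathDet_two, heq]; simp only [map_sub, map_neg]; ring
  have hD4 : pathDet a d b f 4 =
      C (a 3 * (a 2 * (a 1 * a 0 - b 0 ^ 2))) * X ^ (d 3 + (d 2 + 2 * f 0)) + C (a 3 * (-(b 1 ^ 2) * a 0)) * X ^ (d 3 + (2 * f 1 + d 0)) +
        C (-(b 2 ^ 2) * (a 1 * a 0 - b 0 ^ 2)) * X ^ (2 * f 2 + 2 * f 0) := by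
    rw [show (4 : ℕ) = 2 + 2 from rfl, pathDet_add_two, show (2 + 1 : ℕ) = 1 + 2 from rfl, pathDet_add_two, hD2, pathDet_one]
    simp only [map_mul, map_neg, map_pow, map_sub]
    ring
  refine countP_roots_pos_le_of_card_support_le ?_
  rw [hD4]
  exact (Finset.card_le_card (Polynomial.support_trinomial_subset _ _ _ _ _ _)).trans Finset.card_le_three

/-! ### The reduction -/

/-- **`(P)_2 ⟸ «B 4 ≤ 3 WITH MULTIPLICITY»**: if every static definite symmetric tridiagonal `4 × 4` monomial design with nonzero links has at most
three positive determinant zeros counted with multiplicity, then `Θ(rootWord D₃ D₄) ≤ Θ(rootWord D₂ D₃) + 2` for every such design.  Counting only: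
`n₂ ≤ 1`, `n₃ ≤ 2`, `n₄ ≤ 3`, `n₂ = 0 ⇒ n₄ ≤ 2`, `Θ(w) ≤ |w| − [both letters occur]`, `Θ(u) ≥ #p(u), #q(u)`. [this file] -/
theorem potentialStep_two_of_fourMult
    (h4 : ∀ (a : ℕ → ℝ) (d : ℕ → ℕ) (b : ℕ → ℝ) (f : ℕ → ℕ), (∀ t, 0 < a t) → (∀ t, b t ≠ 0) →
      (pathDet a d b f 4).roots.countP (fun x => 0 < x) ≤ 3) :
    PotentialStep 2 := by
  classical
  intro a d b f ha hb
  show theta (rootWord (pathDet a d b f 3) (pathDet a d b f 4)) ≤ theta (rootWord (pathDet a d b f 2) (pathDet a d b f 3)) + 2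
  by_cases h34 : pathDet a d b f 3 * pathDet a d b f 4 = 0
  · rw [rootWord_eq_nil_of_mul_eq_zero h34, theta_nil]; exact Nat.zero_le _
  have hD3 : pathDet a d b f 3 ≠ 0 := left_ne_zero_of_mul h34
  have hD4 : pathDet a d b f 4 ≠ 0 := right_ne_zero_of_mul h34
  -- letter counts of the new word
  set n3 := (pathDet a d b f 3).roots.countP (fun x => 0 < x) with hn3
  set n4 := (pathDet a d b f 4).roots.countP (fun x => 0 < x) with hn4
  have hlen : (rootWord (pathDet a d b f 3) (pathDet a d b f 4)).length = n3 + n4 := length_rootWord h34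
  have hn3le : n3 ≤ 2 := countP_roots_pos_pathDet_three a d b f
  have hn4le : n4 ≤ 3 := h4 a d b f ha hb
  -- `Θ(w) ≤ |w|`, and `≤ |w| − 1` when both letters occur
  have hw1 : theta (rootWord (pathDet a d b f 3) (pathDet a d b f 4)) ≤ n3 + n4 := hlen ▸ theta_le_length _
  have hq : (rootWord (pathDet a d b f 3) (pathDet a d b f 4)).count true = n4 := by
    rw [count_true_rootWord, hn4]
    exact sum_rootMultiplicity_eq _ (fun x hx => (Finset.mem_filter.1 hx).2) (fun x hx => by
      rw [Finset.mem_filter, Multiset.mem_toFinset] at hx ⊢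
      exact ⟨by rw [Polynomial.roots_mul h34]; exact Multiset.mem_add.2 (Or.inr hx.1), hx.2⟩)
  have hp : (rootWord (pathDet a d b f 3) (pathDet a d b f 4)).count false = n3 := by
    have h := List.count_not_add_count (rootWord (pathDet a d b f 3) (pathDet a d b f 4)) true
    simp only [Bool.not_true] at h
    omega
  have hw2 : 1 ≤ n3 → 1 ≤ n4 → theta (rootWord (pathDet a d b f 3) (pathDet a d b f 4)) ≤ n3 + n4 - 1 := by
    intro h3 h4'
    have := theta_le_length_sub_one (rootWord (pathDet a d b f 3) (pathDet a d b f 4)) (by omega) (by omega)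
    rwa [hlen] at this
  -- lower bounds for the old word
  by_cases h23 : pathDet a d b f 2 * pathDet a d b f 3 = 0
  · -- then `D₂ = 0` (as `D₃ ≠ 0`): `D₃ = −w₁ D₁` has no positive zero and `D₄ = a₃X^{d₃} D₃`, so `w` has no letters at all
    have hD2 : pathDet a d b f 2 = 0 := by
      rcases mul_eq_zero.1 h23 with h | h
      · exact h
      · exact absurd h hD3
    have hev3 : ∀ x : ℝ, 0 < x → (pathDet a d b f 3).eval x ≠ 0 := by
      intro x hx
      rw [show (3 : ℕ) = 1 + 2 from rfl, pathDet_add_two, hD2, pathDet_one]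
      simp only [eval_mul, eval_pow, eval_C, eval_X, eval_neg, mul_zero, zero_sub, neg_ne_zero]
      exact mul_ne_zero (pow_ne_zero _ (mul_ne_zero (hb 1) (pow_ne_zero _ hx.ne'))) (mul_ne_zero (ha 0).ne' (pow_ne_zero _ hx.ne'))
    have hn3z : n3 = 0 :=
      Multiset.countP_eq_zero.2 fun x hx hxpos => hev3 x hxpos ((mem_roots hD3).1 hx)
    have hev4 : ∀ x : ℝ, 0 < x → (pathDet a d b f 4).eval x ≠ 0 := by
      intro x hx
      rw [show (4 : ℕ) = 2 + 2 from rfl, pathDet_add_two, hD2]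
      simp only [eval_mul, eval_pow, eval_C, eval_X, mul_zero, sub_zero]
      exact mul_ne_zero (mul_ne_zero (ha 3).ne' (pow_ne_zero _ hx.ne')) (hev3 x hx)
    have hn4z : n4 = 0 :=
      Multiset.countP_eq_zero.2 fun x hx hxpos => hev4 x hxpos ((mem_roots hD4).1 hx)
    omega
  · have hn2le : (pathDet a d b f 2).roots.countP (fun x => 0 < x) ≤ 1 := countP_roots_pos_pathDet_two a d b f
    have hlen' : (rootWord (pathDet a d b f 2) (pathDet a d b f 3)).length =
        (pathDet a d b f 2).roots.countP (fun x => 0 < x) + n3 := length_rootWord h23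
    -- `Θ(u) ≥ #q(u) = n₃` and `Θ(u) ≥ #p(u) = n₂`
    have hq' : (rootWord (pathDet a d b f 2) (pathDet a d b f 3)).count true = n3 := by
      rw [count_true_rootWord, hn3]
      exact sum_rootMultiplicity_eq _ (fun x hx => (Finset.mem_filter.1 hx).2) (fun x hx => by
        rw [Finset.mem_filter, Multiset.mem_toFinset] at hx ⊢
        exact ⟨by rw [Polynomial.roots_mul h23]; exact Multiset.mem_add.2 (Or.inr hx.1), hx.2⟩)
    have hp' : (rootWord (pathDet a d b f 2) (pathDet a d b f 3)).count false = (pathDet a d b f 2).roots.countP (fun x => 0 < x) := by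
      have h := List.count_not_add_count (rootWord (pathDet a d b f 2) (pathDet a d b f 3)) true
      simp only [Bool.not_true] at h
      omega
    have hu1 : n3 ≤ theta (rootWord (pathDet a d b f 2) (pathDet a d b f 3)) := hq' ▸ count_le_theta _ true
    have hu2 : (pathDet a d b f 2).roots.countP (fun x => 0 < x) ≤ theta (rootWord (pathDet a d b f 2) (pathDet a d b f 3)) :=
      hp' ▸ count_le_theta _ false
    -- `n₂ = 0 ⇒ n₄ ≤ 2`
    have h02 : (pathDet a d b f 2).roots.countP (fun x => 0 < x) = 0 → n4 ≤ 2 :=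
      fun h => countP_roots_pos_pathDet_four_le_two_of_two a d b f ha hb h
    -- the counting
    rcases Nat.eq_zero_or_pos n3 with h3 | h3
    · rcases Nat.eq_zero_or_pos n4 with h4' | h4'
      · omega
      · rcases Nat.eq_zero_or_pos ((pathDet a d b f 2).roots.countP (fun x => 0 < x)) with h2 | h2
        · have := h02 h2; omega
        · omega
    · rcases Nat.eq_zero_or_pos n4 with h4' | h4'
      · omega
      · have := hw2 h3 h4'; omega

end StaticTridiagonalRealPotential

end Summit.ValiantsHypothesis.ValiantsHypothesis.Theorems.KPlusLogSqLaw
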